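import Literature.AlgebraicGeometry.AbelianSchemes.PoincareGrothendieckComplexLocallyNilpotent
import Literature.AlgebraicGeometry.AbelianSchemes.PoincarePointRestrictingToUnit
import Literature.AlgebraicGeometry.Modules.GrothendieckComplexSliceHOne
import Literature.AlgebraicGeometry.Modules.CechComplexHOneCechH1
import Literature.AlgebraicGeometry.Dimension.StalkRegularOfSmoothOverField
import Literature.AlgebraicGeometry.Morphisms.GeometricallyConnectedFibreLocusOpen
import Literature.AlgebraicGeometry.Morphisms.CechH1AffineCoverIndependence
import Literature.AlgebraicGeometry.Morphisms.CechH1AffineProofs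
import Literature.AlgebraicGeometry.Morphisms.DevissageHeart
import Literature.AlgebraicGeometry.Morphisms.KPointStalkTestAlgebra
import Literature.AlgebraicGeometry.ProjectiveGeometry.AffineCoverOfCardDimSucc
import Literature.AlgebraicGeometry.AbelianSchemes.LevelStructureRefinement
import Literature.Algebra.Homology.GrothendieckComplexDualExactWiring
import Literature.Algebra.Homology.BaseChangeComplexTowerHOne
import Literature.Algebra.Homology.HmkQBaseChangeComplexRingEquiv
import Literature.AlgebraicGeometry.Morphisms.RelDimOfEtaleSurjectiveComp
import HarnessLib

/-!
# `dim_K Ȟ¹(𝔘, 𝒪_A) = dim Â` from the Poincaré family, in ANY characteristic ([MumfordAV1970] §13 Cor. 2, duality-free)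

Layer `Literature/AlgebraicGeometry/AbelianSchemes`, namespace `Literature.AlgebraicGeometry.AbelianSchemes.AbelianSchemeOver`.  THEOREMS ONLY (no
definition, no named fact, no instance, no notation, no `sorry`).  Cell `hodgecm-mathlib` (D-0151), P6 «MOD programme»: the HEAD (H-a) of the
«H1-DIM-ANY-CHAR cut» (B-p04 (g40)–(g42), memo `MEMO-H1DIM-cut.v4`; L1∕L4∕L5 hands LA1-p02∕p03, LA4-p05, LA5-p02, LA6-p02, B-p08, B-p10, B-p18).

THE THEOREM.  Over an algebraically closed field `K`, let `(A, Â, π, L, 𝒫)` be standing Poincaré data ([MumfordAV1970] §13: `π : A → Â` a flat surjective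
homomorphism of abelian schemes over `K` with kernel functor `K(L)` for a rigidified line bundle `L` on `A`, `𝒫` a line bundle on `A × Â` with
`(1 × π)^*𝒫 ≅ Λ(L)` and every slice `𝒫|_{A × {b}}` in `Pic⁰`), `A` and `Â` of (relative) dimension `g`.  Then for EVERY finite affine open cover
`𝔘` of `A`, `Ȟ¹(𝔘, 𝒪_A)` is a finite `K`-vector space of dimension `g`.

THE PROOF (Mumford's, through the tree's bricks; no duality, no spectral sequence).  Finiteness is ★ `cechH1_finite_holds`; by ★ cover independence
we may take the `(g+1)`-member affine cover of ★ `AbelianVariety.exists_affineCover_fin_dim_succ'` (`g = 0`: `A` is affine and `Ȟ¹ = 0`, ★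
`cechH1_affine_vanishing_holds`).  Let `V ∋ 0̂` be an affine open of `Â`, `t₀ : Spec K → V` the unit point, `R := 𝒪_{V,0̂}` (regular of dimension
`g`, ★ (REG) `StalkRegularOfSmoothOverField`), `𝓥` the box cover of `A × V`, `K• ⥲ Č•(𝓥, 𝒫_V)` the Grothendieck complex (★ `grothendieckComplex`).
The wired entry point ★ `finrank_HOne_baseChangeComplex_residueField_eq_of_torsion` ([MumfordAV1970] §13 pp. 127–129 = ★ B1 acyclicity lemma + ★ B2∕(R1)
dual exactness + ★ B3 `β₁(k) = dim 𝔪∕𝔪²`) gives `dim_{κ(R)} H¹(κ(R) ⊗_R (R ⊗ K•)) = dim_{κ(R)} 𝔪_R∕𝔪_R² = g`, its inputs being ★ (ε) `Q_R ≅ κ(R)`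
(`PoincareGrothendieckComplexResidueFieldRepr`), ★ (NIL) `𝔪_R`-power torsion (`PoincareGrothendieckComplexLocallyNilpotent`) and ★ `d^g ⊗ R` onto.
Then `H¹(κ(R) ⊗_R (R ⊗ K•)) ≅ H¹(κ(R) ⊗ K•)` (★ tower), `κ(R) ≅ Γ(Spec K, 𝒪)` over `Γ(V)` (★ `Morphisms/KPointStalkTestAlgebra`, ★ `HmkQBaseChangeComplexRingEquiv`),
`H¹(Γ(Spec K) ⊗ K•) ≅ H¹(Č•((𝟙,0̂)⁻¹𝓥, (𝟙,0̂)^*𝒫_V))` (★ slice reading `GrothendieckComplexSliceHOne`, [MumfordAV1970] §5 Cor. 2),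
`(𝟙,0̂)^*𝒫_V ≅ 𝒪_A` (★ `nonempty_pullback_pullback_poincare_iso_unitModule_of_comp_eq_one`), and `H¹(Č_ord(𝔘, 𝒪_A; Γ(Spec K))) ≅ Ȟ¹(𝔘, 𝒪_A)`
(★ `CechComplexHOneCechH1`).

HC_CM is proved only modulo the printed citations until rung 0 closes; nothing here is about HC (count-neutral ★ capital).  The hypothesis-free
form for every abelian variety requires quotients by finite NON-étale group schemes ([MumfordAV1970] §12) and is not claimed here.

## References
* [MumfordAV1970] D. Mumford, *Abelian Varieties* (1970), §13, the Theorem and its proof (pp. 125–129), Cor. 2 (p. 129); §5 Cor. 2 (pp. 50–51).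
* [Hartshorne1977] R. Hartshorne, *Algebraic Geometry* (1977), III Thm. 4.5 (p. 222), III Thm. 12.11 (p. 290).
* [GortzWedhorn2023] U. Görtz, T. Wedhorn, *Algebraic Geometry II* (2023), Cor. 23.135 (p. 355), Thm. 22.9 (p. 236).
-/

set_option autoImplicit false

noncomputable section

-- `Scheme.Modules` / cartesian-monoidal `Over` products are not reducible (as in ★ `PoincareGrothendieckComplexResidueFieldRepr`).
set_option backward.isDefEq.respectTransparency false

open CategoryTheory CategoryTheory.Limits AlgebraicGeometry MonoidalCategory CartesianMonoidalCategory TensorProduct IsLocalRing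
  TopologicalSpace
open scoped MonObj

namespace Literature.AlgebraicGeometry.AbelianSchemes

namespace AbelianSchemeOver

open Literature.AlgebraicGeometry.Motives Literature.AlgebraicGeometry.Modules Literature.Algebra.Homology
  Literature.AlgebraicGeometry.AbelianVarieties Literature.AlgebraicGeometry.Morphisms Literature.AlgebraicGeometry.Dimension
  Literature.AlgebraicGeometry.ProjectiveGeometry

universe u

/-! ## §1 Plumbing at the unit point -/

section UnitPoint

variable {K : Type} [Field K] (hat : AbelianSchemeOver (Spec (CommRingCat.of K)))

/-- `(1 : Y ⟶ Â).left = Y.hom ≫ ε_Â`. [cite: MumfordAV1970, §13, proof of the Theorem (pp. 127–129)] -/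
private theorem one_left_eq'' (Y : SchemeOver K) : (1 : Y ⟶ hat.X).left = Y.hom ≫ hat.unitSection := by
  rw [Hom.one_def, Over.comp_left, Over.toUnit_left]

/-- The range of the unit section `ε_Â : Spec K → Â` is the single point `0̂ = ε_Â(𝔪)`. [cite: MumfordAV1970, §13 (p. 125)] -/
theorem range_unitSection_base : Set.range hat.unitSection.base = {hat.unitSection.base (closedPoint K)} := by
  ext z
  constructor
  · rintro ⟨p, rfl⟩
    rw [Set.mem_singleton_iff, show p = closedPoint K from Subsingleton.elim _ _]
  · rintro rfl
    exact ⟨_, rfl⟩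

end UnitPoint

/-! ## §2 The theorem -/

section Head

variable {K : Type} [Field K] [IsAlgClosed K] (A hat : AbelianSchemeOver (Spec (CommRingCat.of K))) (π : A.X ⟶ hat.X) [IsMonHom π]
  [Flat π.left] [Surjective π.left]
  {L : A.left.Modules} (hL : HasRank L 1)
  (hε : CechPic.pullback A.unitSection (detClass (HasRank.isFiniteLocallyFree' hL)) = 1)
  (hker : ∀ (T : Over (Spec (CommRingCat.of K))) (u : T ⟶ A.X), u ≫ π = 1 ↔ A.MemKOfL L u)
  (P : (A.prodLeft hat).Modules)
  (hsock : Nonempty ((Scheme.Modules.pullback (A.X ◁ π).left).obj P ≅ A.mumfordBundle L)) (hP1 : HasRank P 1)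
  (hpic : ∀ b : Spec (CommRingCat.of K) ⟶ hat.X.left,
    IsHomogeneous (A.fibre (b ≫ hat.X.hom)).toAbelianVariety ((Scheme.Modules.pullback (A.fibreSlice hat b)).obj P))
  {g : ℕ} (hA : A.IsOfRelDim g) (hhat : hat.IsOfRelDim g)
  [IsProper A.X.hom] [GeometricallyIntegral A.X.hom] [Flat A.X.hom] [UniversallyOpen A.X.hom]

include hL hε hker hsock hP1 hpic hA hhat in
/-- **[MumfordAV1970] §13 Cor. 2 FROM THE POINCARÉ FAMILY, ANY CHARACTERISTIC**: over `K = K̄`, for standing Poincaré data `(A, Â, π, L, 𝒫)` with every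
slice `𝒫|_{A × {b}}` in `Pic⁰` and `A`, `Â` of relative dimension `g`, and for EVERY finite affine open cover `𝔘` of `A`:
`Ȟ¹(𝔘, 𝒪_A)` is a finite `K`-module of rank `g`. [cite: MumfordAV1970, §13 Cor. 2 (p. 129) and the proof of the Theorem (pp. 125–129)]
[cite: Hartshorne1977, III Thm. 4.5 (p. 222)] -/
theorem finite_finrank_cechH1_eq_of_poincareData {J : Type} [Finite J] (U : J → A.X.left.Opens) (hU : ∀ i, IsAffineOpen (U i))
    (hUcov : iSup U = ⊤) : Module.Finite K (CechH1 A.X.hom U) ∧ Module.finrank K (CechH1 A.X.hom U) = g := by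
  classical
  have hUcov' : ⨆ i, U i = ⊤ := hUcov
  refine ⟨cechH1_finite_holds A.X.hom U hU hUcov', ?_⟩
  /- (A) the `(g+1)`-member affine cover of `A` and cover independence -/
  obtain ⟨U₀, hU₀, hU₀cov⟩ := AbelianVariety.exists_affineCover_fin_dim_succ' A.toAffine.toAbelianVariety
  have hdimA : A.toAffine.toAbelianVariety.dim = g := A.dim_toAbelianVariety_of_isOfRelDim hA
  rw [finrank_cechH1_eq_of_isAffineOpen A.X.hom U U₀ hU hU₀ hUcov' hU₀cov]
  /- (B) `g = 0`: `A` is affine and `Ȟ¹ = 0` -/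
  rcases Nat.eq_zero_or_pos g with hg0 | hgpos
  · subst hg0
    have hsub : ∀ i j : Fin (A.toAffine.toAbelianVariety.dim + 1), i = j := fun i j => Fin.ext (by omega)
    have htop : U₀ ⟨0, by omega⟩ = ⊤ := by
      rw [← hU₀cov]
      exact le_antisymm (le_iSup U₀ _) (iSup_le fun i => by rw [hsub i ⟨0, by omega⟩])
    have haff : IsAffineOpen (⊤ : A.X.left.Opens) := htop ▸ hU₀ _
    haveI : Subsingleton (CechH1 A.X.hom U₀) :=
      ⟨fun x y => by
        rw [cechH1_affine_vanishing.eq_zero cechH1_affine_vanishing_holds A.X.hom haff U₀ hU₀cov x,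
          cechH1_affine_vanishing.eq_zero cechH1_affine_vanishing_holds A.X.hom haff U₀ hU₀cov y]⟩
    exact Module.finrank_zero_of_subsingleton
  /- (C) an affine open `V ∋ 0̂` of `Â`, the test base `T = (V → Â → Spec K)` and its `K`-point `t₀` -/
  obtain ⟨V, hVaff, h0V, -⟩ := exists_isAffineOpen_mem_and_subset (X := hat.X.left) (U := ⊤)
    (Opens.mem_top (hat.unitSection.base (closedPoint K)))
  haveI : IsAffine (V : Scheme) := hVaff
  haveI := hat.isProper
  haveI : IsLocallyNoetherian hat.X.left := LocallyOfFiniteType.isLocallyNoetherian hat.X.hom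
  haveI : IsLocallyNoetherian (V : Scheme) := isLocallyNoetherian_of_isOpenImmersion V.ι
  haveI : IsNoetherianRing Γ((V : Scheme), ⊤) := IsLocallyNoetherian.component_noetherian ⟨⊤, isAffineOpen_top _⟩
  let T : SchemeOver K := Over.mk (V.ι ≫ hat.X.hom)
  let gT : T ⟶ hat.X := Over.homMk V.ι rfl
  haveI : IsAffine T.left := hVaff
  haveI : IsNoetherianRing Γ(T.left, ⊤) := inferInstanceAs (IsNoetherianRing Γ((V : Scheme), ⊤))
  haveI : IsLocallyNoetherian T.left := inferInstanceAs (IsLocallyNoetherian (V : Scheme))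
  haveI : LocallyOfFiniteType T.hom := inferInstanceAs (LocallyOfFiniteType (V.ι ≫ hat.X.hom))
  haveI : Mono gT.left := inferInstanceAs (Mono V.ι)
  have hrange : Set.range hat.unitSection.base ⊆ Set.range V.ι.base := by
    rw [range_unitSection_base, Scheme.Opens.range_ι, Set.singleton_subset_iff]
    exact h0V
  let t₀ : Spec (CommRingCat.of K) ⟶ T.left := IsOpenImmersion.lift V.ι hat.unitSection hrange
  have ht₀ : t₀ ≫ gT.left = hat.unitSection := IsOpenImmersion.lift_fac V.ι hat.unitSection hrange
  have ht₀K : t₀ ≫ T.hom = 𝟙 _ := by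
    change t₀ ≫ V.ι ≫ hat.X.hom = 𝟙 _
    rw [← Category.assoc]
    change (t₀ ≫ gT.left) ≫ hat.X.hom = 𝟙 _
    rw [ht₀, unitSection_comp_hom]
  /- (D) the box cover of `A × V`, the Poincaré bundle `𝒫_V`, the Grothendieck complex -/
  haveI : IsAffineHom (fst A.X T).left := by
    change IsAffineHom (pullback.fst A.X.hom T.hom)
    exact MorphismProperty.pullback_fst (P := @IsAffineHom) _ _ inferInstance
  let 𝓥 : Fin (A.toAffine.toAbelianVariety.dim + 1) → (A.X ⊗ T).left.Opens := fun i => (fst A.X T).left ⁻¹ᵁ U₀ i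
  haveI := A.isProper
  haveI : A.X.left.IsSeparated := by
    refine ⟨?_⟩
    rw [← terminal.comp_from (A.X.hom ≫ 𝟙 _), Category.comp_id]
    infer_instance
  have hU₀s : ∀ s : Finset (Fin (A.toAffine.toAbelianVariety.dim + 1)), s.Nonempty → IsAffineOpen (cechOpen U₀ s) :=
    fun s hs => isAffineOpen_cechOpen_of_nonempty (fun i => (⟨U₀ i, hU₀ i⟩ : A.X.left.affineOpens)) hs
  have hV : ∀ s : Finset (Fin (A.toAffine.toAbelianVariety.dim + 1)), s.Nonempty → IsAffineOpen (cechOpen 𝓥 s) := by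
    intro s hs
    have h := (hU₀s s hs).preimage (fst A.X T).left
    rw [preimage_cechOpen] at h
    exact h
  have hcov : ⨆ i, 𝓥 i = ⊤ := by
    change ⨆ i, (fst A.X T).left ⁻¹ᵁ U₀ i = ⊤
    rw [← Scheme.Hom.preimage_iSup, hU₀cov, Scheme.Hom.preimage_top]
  have hPT : HasRank ((Scheme.Modules.pullback (A.X ◁ gT).left).obj P) 1 := hasRank_pullback _ hP1
  have hsp := grothendieckComplex_spec A.X T 𝓥 ((Scheme.Modules.pullback (A.X ◁ gT).left).obj P) hV hcov hPT
  haveI := hsp.1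
  haveI := hsp.2.1
  /- (E) the local ring `R = 𝒪_{V,0̂}` under `Γ(V)`, regular of dimension `g` -/
  let R : Type := T.left.presheaf.stalk (t₀.base (closedPoint K))
  letI algR : Algebra Γ(T.left, ⊤) R := (T.left.presheaf.germ ⊤ (t₀.base (closedPoint K)) trivial).hom.toAlgebra
  have hx : IsClosed ({t₀.base (closedPoint K)} : Set T.left) := isClosed_singleton_base_closedPoint T.hom t₀ ht₀K
  have hmax : (RingHom.ker t₀.appTop.hom).map (algebraMap Γ(T.left, ⊤) R) = maximalIdeal R :=
    map_ker_appTop_eq_maximalIdeal_stalk t₀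
  letI algΓ : Algebra Γ(T.left, ⊤) Γ(Spec (CommRingCat.of K), ⊤) := (t₀.appLE ⊤ ⊤ le_top).hom.toAlgebra
  letI algκ : Algebra Γ(T.left, ⊤) (ResidueField R) := ((residue R).comp (algebraMap Γ(T.left, ⊤) R)).toAlgebra
  haveI : IsScalarTower Γ(T.left, ⊤) R (ResidueField R) := IsScalarTower.of_algebraMap_eq fun _ => rfl
  obtain ⟨e, he⟩ : ∃ e : ResidueField R ≃+* Γ(Spec (CommRingCat.of K), ⊤),
      ∀ a : Γ(T.left, ⊤), e (algebraMap Γ(T.left, ⊤) (ResidueField R) a) = algebraMap Γ(T.left, ⊤) Γ(Spec (CommRingCat.of K), ⊤) a :=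
    exists_ringEquiv_residueField_stalk T.hom t₀ ht₀K
  haveI : SmoothOfRelativeDimension g hat.X.hom := (hat.isOfRelDim_iff g).mp hhat
  haveI : SmoothOfRelativeDimension g T.hom := by
    have h : SmoothOfRelativeDimension (0 + g) (V.ι ≫ hat.X.hom) := inferInstance
    rw [zero_add] at h
    exact h
  obtain ⟨rs, hrs, hspan, hlen⟩ := exists_isWeaklyRegular_stalk_of_isClosed T.hom g hx
  have hcot := finrank_cotangentSpace_stalk_eq_of_isClosed T.hom g hx
  /- (F) the local count `dim H¹(κ(R) ⊗ K•) = g` -/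
  have hcardZ : ((Fintype.card (Fin (A.toAffine.toAbelianVariety.dim + 1)) : ℕ) : ℤ) = (g : ℤ) + 1 := by
    rw [Fintype.card_fin, hdimA]; push_cast; ring
  haveI : (grothendieckComplex A.X T 𝓥 ((Scheme.Modules.pullback (A.X ◁ gT).left).obj P) hV hcov hPT).IsStrictlyLE ((g : ℤ) + 1) := by
    have h := hsp.2.2.1
    rwa [hcardZ] at h
  haveI : (cechComplex 𝓥 ((Scheme.Modules.pullback (A.X ◁ gT).left).obj P) (baseToTotal A.X T)).IsStrictlyLE (g : ℤ) :=
    isStrictlyLE_cechComplex _ _ _ _ (by rw [hcardZ])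
  haveI : Flat (snd A.X T).left := Modules.flat_snd_left A.X T
  have hCflat : ∀ n, Module.Flat Γ(T.left, ⊤)
      ((cechComplex 𝓥 ((Scheme.Modules.pullback (A.X ◁ gT).left).obj P) (baseToTotal A.X T)).X n) :=
    flat_cechComplex_X 𝓥 _ _ (flat_secMod_of_flat (snd A.X T).left 𝓥 hV _ (HasRank.isFiniteLocallyFree' hPT))
  have hd := surjective_baseChangeComplex_d_of_quasiIso R _
    (grothendieckMap A.X T 𝓥 ((Scheme.Modules.pullback (A.X ◁ gT).left).obj P) hV hcov hPT) hsp.2.2.2 hCflat (g : ℤ)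
  have hnil := A.locallyNilpotent_cocycles_baseChangeComplex_grothendieckComplex hat π hL hε hker P hsock hpic T gT t₀ ht₀ ht₀K
    𝓥 hV hcov hPT hmax
  obtain ⟨ε', hε', h₁⟩ := A.exists_residueField_surjective_exact_lcomp_baseChange_grothendieckComplex hat π hL hε hker P hsock hP1
    T gT t₀ ht₀ ht₀K 𝓥 hV hcov hPT hmax
  have hcount := finrank_HOne_baseChangeComplex_residueField_eq_of_torsion R _ hsp.2.2.2 (g : ℤ) (by exact_mod_cast hgpos) rs hrs
    (by rw [hlen]) hd (fun r hr => hnil r (hspan ▸ Ideal.subset_span hr)) ε' hε' h₁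
  rw [hcot, finrank_HOne_baseChangeComplex_tower_eq (R := R) (ResidueField R), finrank_HmkQ_baseChangeComplex_eq_of_ringEquiv _ e he 0 1 2]
    at hcount
  /- (G) the slice at the unit point `(𝟙, 0̂) : A → A × V` reads `K• ⊗ Γ(Spec K)` as `Č•(𝔘₀, 𝒫|_{A × 0̂})` -/
  have hyw : t₀ ≫ T.hom = Spec.map (CommRingCat.ofHom (algebraMap K K)) := by
    rw [ht₀K, Algebra.algebraMap_self, CommRingCat.ofHom_id, Spec.map_id]
  let y : AlgPoints T K := AlgPoints.mk t₀ hyw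
  have hslice := finrank_HOne_baseChangeComplex_grothendieckComplex_eq_slice A.X T 𝓥
    ((Scheme.Modules.pullback (A.X ◁ gT).left).obj P) hV hcov hPT y
  rw [hslice] at hcount
  /- (H) `(𝟙, 0̂)^*𝒫_V ≅ 𝒪_A`: `(𝟙, 0̂) = (A ≅ A × Spec K) ≫ (1 × y)` with `y ≫ gT = 1` -/
  have hy1 : y ≫ gT = 1 := by
    ext
    rw [Over.comp_left, one_left_eq'' hat]
    change t₀ ≫ V.ι = Spec.map (CommRingCat.ofHom (algebraMap K K)) ≫ hat.unitSection
    rw [Algebra.algebraMap_self, CommRingCat.ofHom_id, Spec.map_id, Category.id_comp]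
    exact ht₀
  have hfac : (lift (𝟙 A.X) (toSpecOver A.X ≫ y)).left = (lift (𝟙 A.X) (toSpecOver A.X)).left ≫ (A.X ◁ y).left := by
    rw [← Over.comp_left, lift_whiskerLeft]
  obtain ⟨e₁⟩ := A.nonempty_pullback_pullback_poincare_iso_unitModule_of_comp_eq_one hat π hL hε P hsock y gT hy1
  obtain ⟨e₂⟩ := nonempty_pullback_unitModule_iso (lift (𝟙 A.X) (toSpecOver A.X)).left
  have eM : (Scheme.Modules.pullback (lift (𝟙 A.X) (toSpecOver A.X ≫ y)).left).obj
      ((Scheme.Modules.pullback (A.X ◁ gT).left).obj P) ≅ unitModule A.X.left :=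
    (Scheme.Modules.pullbackCongr hfac).app _ ≪≫
      ((Scheme.Modules.pullbackComp (lift (𝟙 A.X) (toSpecOver A.X)).left (A.X ◁ y).left).app _).symm ≪≫
      (Scheme.Modules.pullback (lift (𝟙 A.X) (toSpecOver A.X)).left).mapIso e₁ ≪≫ e₂
  rw [(finrank_HOne_cechComplex_eq_of_iso_unitModule A.X.hom.appTop.hom eM (fun i => (lift (𝟙 A.X) (toSpecOver A.X ≫ y)).left ⁻¹ᵁ 𝓥 i)).1,
    (finrank_HOne_cechComplex_appTop_eq_finrank_cechH1 A.X.hom (fun i => (lift (𝟙 A.X) (toSpecOver A.X ≫ y)).left ⁻¹ᵁ 𝓥 i)).1] at hcount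
  /- (I) the pulled-back cover is `𝔘₀` -/
  have h𝓦 : (fun i => (lift (𝟙 A.X) (toSpecOver A.X ≫ y)).left ⁻¹ᵁ 𝓥 i) = U₀ := by
    funext i
    change (lift (𝟙 A.X) (toSpecOver A.X ≫ y)).left ⁻¹ᵁ ((fst A.X T).left ⁻¹ᵁ U₀ i) = U₀ i
    rw [← Scheme.Hom.comp_preimage, ← Over.comp_left, lift_fst]
    rfl
  have hfinal := congrArg (fun W : Fin (A.toAffine.toAbelianVariety.dim + 1) → A.X.left.Opens => Module.finrank K (CechH1 A.X.hom W)) h𝓦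
  exact hfinal.symm.trans hcount

end Head

/-! ## §3 (ED. 2) The étale form: `dim Â = dim A` comes for free when `π` is étale -/

section Etale

variable {K : Type} [Field K] (A hat : AbelianSchemeOver (Spec (CommRingCat.of K))) (π : A.X ⟶ hat.X)

/-- **`Â` has relative dimension `g` when `A` does and `π : A → Â` is étale surjective** (EGA IV₄ 17.7.7: the relative dimension descends
along an étale surjective morphism of the source, ★ `Morphisms.smoothOfRelativeDimension_of_comp_eq_of_etale`; `Â → Spec K` is smooth as an
abelian scheme).  Discharges the binder `hhat` of `finite_finrank_cechH1_eq_of_poincareData` for the data produced by ★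
`MumfordQuotientConstructionAnyChar` (`π` finite étale surjective). [cite: Grothendieck1967, Prop. 17.7.7] [cite: MumfordAV1970, §7 Thm. 4 (p. 72)] -/
theorem isOfRelDim_of_etale_surjective_hom [Etale π.left] [Surjective π.left] {g : ℕ} (hA : A.IsOfRelDim g) : hat.IsOfRelDim g := by
  haveI : SmoothOfRelativeDimension g A.X.hom := (A.isOfRelDim_iff g).mp hA
  haveI : Smooth hat.X.hom := hat.isSmooth
  exact (hat.isOfRelDim_iff g).mpr
    (smoothOfRelativeDimension_of_comp_eq_of_etale π.left hat.X.hom A.X.hom (Over.w π) g)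

variable [IsAlgClosed K] [IsMonHom π] [Etale π.left] [Surjective π.left]
  {L : A.left.Modules} (hL : HasRank L 1)
  (hε : CechPic.pullback A.unitSection (detClass (HasRank.isFiniteLocallyFree' hL)) = 1)
  (hker : ∀ (T : Over (Spec (CommRingCat.of K))) (u : T ⟶ A.X), u ≫ π = 1 ↔ A.MemKOfL L u)
  (P : (A.prodLeft hat).Modules)
  (hsock : Nonempty ((Scheme.Modules.pullback (A.X ◁ π).left).obj P ≅ A.mumfordBundle L)) (hP1 : HasRank P 1)
  (hpic : ∀ b : Spec (CommRingCat.of K) ⟶ hat.X.left,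
    IsHomogeneous (A.fibre (b ≫ hat.X.hom)).toAbelianVariety ((Scheme.Modules.pullback (A.fibreSlice hat b)).obj P))
  {g : ℕ} (hA : A.IsOfRelDim g)
  [IsProper A.X.hom] [GeometricallyIntegral A.X.hom] [Flat A.X.hom] [UniversallyOpen A.X.hom]

include hL hε hker hsock hP1 hpic hA in
/-- **[MumfordAV1970] §13 Cor. 2 from the Poincaré family, étale form**: as `finite_finrank_cechH1_eq_of_poincareData`, with `π : A → Â` ÉTALE
surjective (the output of ★ `MumfordQuotientConstructionAnyChar`) and the single dimension hypothesis `A.IsOfRelDim g`.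
[cite: MumfordAV1970, §13 Cor. 2 (p. 129) and the proof of the Theorem (pp. 125–129)] [cite: Grothendieck1967, Prop. 17.7.7] -/
theorem finite_finrank_cechH1_eq_of_poincareData_of_etale {J : Type} [Finite J] (U : J → A.X.left.Opens)
    (hU : ∀ i, IsAffineOpen (U i)) (hUcov : iSup U = ⊤) :
    Module.Finite K (CechH1 A.X.hom U) ∧ Module.finrank K (CechH1 A.X.hom U) = g :=
  A.finite_finrank_cechH1_eq_of_poincareData hat π hL hε hker P hsock hP1 hpic hA
    (A.isOfRelDim_of_etale_surjective_hom hat π hA) U hU hUcov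

end Etale

/-! ## §4 (ED. 3) Minimal binders: the four structural instances of `A → Spec K` come from `AbelianSchemeOver` -/

section Minimal

variable {K : Type} [Field K] [IsAlgClosed K] (A hat : AbelianSchemeOver (Spec (CommRingCat.of K))) (π : A.X ⟶ hat.X)
  [IsMonHom π] [Etale π.left] [Surjective π.left]
  {L : A.left.Modules} (hL : HasRank L 1)
  (hε : CechPic.pullback A.unitSection (detClass (HasRank.isFiniteLocallyFree' hL)) = 1)
  (hker : ∀ (T : Over (Spec (CommRingCat.of K))) (u : T ⟶ A.X), u ≫ π = 1 ↔ A.MemKOfL L u)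
  (P : (A.prodLeft hat).Modules)
  (hsock : Nonempty ((Scheme.Modules.pullback (A.X ◁ π).left).obj P ≅ A.mumfordBundle L)) (hP1 : HasRank P 1)
  (hpic : ∀ b : Spec (CommRingCat.of K) ⟶ hat.X.left,
    IsHomogeneous (A.fibre (b ≫ hat.X.hom)).toAbelianVariety ((Scheme.Modules.pullback (A.fibreSlice hat b)).obj P))
  {g : ℕ} (hA : A.IsOfRelDim g)

include hL hε hker hsock hP1 hpic hA in
/-- **[MumfordAV1970] §13 Cor. 2 from the Poincaré family — minimal binders**: as `finite_finrank_cechH1_eq_of_poincareData_of_etale`, without the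
instance binders `[IsProper A.X.hom] [GeometricallyIntegral A.X.hom] [Flat A.X.hom] [UniversallyOpen A.X.hom]` (proper and smooth are fields of
`AbelianSchemeOver`; smooth ⇒ flat ⇒ universally open (Mathlib); geometrically integral by ★ `AbelianScheme.geometricallyIntegral_hom`).
[cite: MumfordAV1970, §13 Cor. 2 (p. 129) and the proof of the Theorem (pp. 125–129)] -/
theorem finite_finrank_cechH1_eq_of_poincareData' {J : Type} [Finite J] (U : J → A.X.left.Opens)
    (hU : ∀ i, IsAffineOpen (U i)) (hUcov : iSup U = ⊤) :
    Module.Finite K (CechH1 A.X.hom U) ∧ Module.finrank K (CechH1 A.X.hom U) = g := by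
  haveI := A.isProper
  haveI := A.isSmooth
  haveI : GeometricallyIntegral A.X.hom := A.toAffine.geometricallyIntegral_hom
  exact A.finite_finrank_cechH1_eq_of_poincareData_of_etale hat π hL hε hker P hsock hP1 hpic hA U hU hUcov

end Minimal

end AbelianSchemeOver

end Literature.AlgebraicGeometry.AbelianSchemes

end
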